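import Summits.NavierStokesRegularity.NavierStokesRegularity.Theorems.StrainDoorsLinearPressureSplit
import HarnessLib

/-!
# Strain doors, PART M §M29(c) — LINK 1, second half: the pressure pairing of the local energy inequality is
# LINEAR in the local energies under a sup bound, with `M`-free constants

ROUND 70 of the `ns-regularity-ideate` programme (p1 line; helper lane of `stmt-NavierStokesRegularity-0056`,
rung N0; nothing here is a claim about Navier–Stokes regularity).  ROUND 69 proved door X′ (the `L²`-Morrey Type-I
bound from the sup-norm rate IN THE ENERGY CLASS, constant `M₂(M, ‖u₀‖₂, T₀)`) and typed door X″
`UlocMorreyBoundSupTypeI`: the same bound with an `M`-ONLY constant at all radii `r² < T`.  ROUND 70 CLOSES X″ by a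
uniformly-local energy Grönwall argument under the rate, in three links, ALL PROVED: LINK 1 (the pressure pairing of
the local energy inequality is LINEAR in the local energies under a sup bound, `M`-free constants — texts N11a/N11b),
LINK 2 (the sliced local energy inequality under the rate at unit scale is linear with `M`-only data — typed in N11c,
PROVED in N11e/N11f/N11g), LINK 3 (LINK 2 ⇒ X″ by Grönwall and Leray rescaling — N11c); N11d puts them together:
`ulocMorreyBoundSupTypeI_holds : UlocMorreyBoundSupTypeI`.

THIS FILE (imports §M29(a)–(b) `StrainDoorsLinearPressureSplit`; tree otherwise):
* `exists_enorm_farPressure_le_of_uloc` — the two-centre far-field bound on `B(x₀, r)`, `r ≥ 1`, by the unit-scale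
  uniformly local energy: `‖∫_{B_{2r}ᶜ} (K(x−y) − K(x₀−y)) w⊗w‖ ≤ F(r) · sup_z ∫_{B(z,1)} |w|²` (tree: two-centre
  kernel bound `exists_abs_pressureKernel_sub_le`, tail lemma `exists_farField_tail_le`, `enorm_localPressureFar_le`);
* §M29(c) ★★ `exists_pressurePairing_le_linear` — for `r ≥ 1`, constants `C₁` (absolute), `C₂(r)`: for every
  measurable slice `w` (`|w|² ∈ L¹ ∩ L^{3/2}`, `|w| ≤ K_b` on `B(x₀,2r)`, `sup_z ∫_{B(z,1)}|w|² ≤ α`) and every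
  bounded measurable `g` supported in `B(x₀, r)` with `∫⟪w, g⟫ = 0`:
  `|∫ p̃[w] ⟪w, g⟫| ≤ K_b ‖g‖_∞ (C₁ ∫_{B(x₀,2r)} |w|² + C₂ α)` — ONE power of `K_b`, so under the rate
  `K_b = M/√(T−s)` the pressure term of the local energy inequality has a time-integrable, `M`-only weight.
Helpers: `enorm_indicator_sq`, `eLpNorm_two_eq_sqrt`, `eLpNorm_two_mul_self`.  No `sorry`, no new axioms, no
instances, no notation, no definitions.
-/

noncomputable section

set_option linter.dupNamespace false

open MeasureTheory Set Function Filter Metric Real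
open _root_.Topology
open scoped ENNReal NNReal RealInnerProductSpace
open Literature.Analysis Literature.Analysis.FluidPDE

namespace Summit.NavierStokesRegularity.NavierStokesRegularity.Theorems.StrainDoors

/-! ### §M29(c) The far field under uniformly-local control, and the LINEAR pressure pairing -/

/-- **The far-field pressure on the inner ball is bounded by the uniformly local energy** (Jia–Šverák
2014 (3.3) / Kang–Miura–Tsai 2021 Lemma 3.4; the tree's
`JiaSverak2014.exists_enorm_localPressureFar_le_of_uloc` is the same bound for `r ≤ 1/2`, here for
inner radii `r ≥ 1` and unit uniformly-local balls, for a single slice, inside this file's import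
cone): for `r ≥ 1` there is `F = F(r) < ∞` such that for every measurable slice `w` with
`∫_{B(z,1)} |w|² ≤ α` for all `z` and every `x ∈ B(x₀, r)`,
`‖∫_{B(x₀,2r)ᶜ} (K(x−y) − K(x₀−y))(w(y)) dy‖ ≤ F · α`. [cite: JiaSverak2014, formula (3.3) p. 7] [cite: KangMiuraTsai2020, Lemma 3.4, arXiv:1812.10509 p. 18] -/
theorem exists_enorm_farPressure_le_of_uloc {r : ℝ} (hr : 1 ≤ r) :
    ∃ F : ℝ≥0∞, F ≠ ⊤ ∧ ∀ {w : EuclideanSpace ℝ (Fin 3) → EuclideanSpace ℝ (Fin 3)}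
      {x₀ : EuclideanSpace ℝ (Fin 3)} {α : ℝ≥0∞}, AEStronglyMeasurable w volume →
      (∀ z : EuclideanSpace ℝ (Fin 3), ∫⁻ y in ball z 1, ‖w y‖ₑ ^ 2 ≤ α) →
      ∀ x ∈ ball x₀ r,
        ‖∫ y in (ball x₀ (2 * r))ᶜ, (pressureKernel (x - y) (w y) - pressureKernel (x₀ - y) (w y))‖ₑ ≤
          F * α := by
  have hr0 : 0 < r := by linarith
  obtain ⟨CK, hCK0, hCK⟩ := exists_abs_pressureKernel_sub_le
  obtain ⟨Kt, hKtt, hKtail⟩ := exists_farField_tail_le (r := 1) one_pos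
  refine ⟨ENNReal.ofReal (CK * r) * (Kt * ENNReal.ofReal ((2 * r - 1)⁻¹)), ?_, ?_⟩
  · exact ENNReal.mul_ne_top ENNReal.ofReal_ne_top (ENNReal.mul_ne_top hKtt ENNReal.ofReal_ne_top)
  intro w x₀ α hm hα x hx
  have h1 := enorm_localPressureFar_le hCK0 hCK x₀ hr0 (fun _ => w) 0 hx
  rw [localPressureFar_apply] at h1
  have htail := hKtail (fun y => ‖w y‖ₑ ^ (2 : ℕ)) (hm.aemeasurable.enorm.pow_const _) α hα x₀
    (2 * r) (by linarith)
  have hker : ∀ y : EuclideanSpace ℝ (Fin 3), RieszKernel.powKer 4 (y - x₀) =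
      ENNReal.ofReal ((‖y - x₀‖ ^ 4)⁻¹) := fun y => by
    unfold RieszKernel.powKer
    rw [Real.rpow_neg (norm_nonneg _), show (4 : ℝ) = ((4 : ℕ) : ℝ) by norm_num, Real.rpow_natCast]
  simp_rw [hker] at h1
  calc ‖∫ y in (ball x₀ (2 * r))ᶜ, (pressureKernel (x - y) (w y) - pressureKernel (x₀ - y) (w y))‖ₑ
      ≤ ENNReal.ofReal (CK * r) * ∫⁻ y in (ball x₀ (2 * r))ᶜ, ‖w y‖ₑ ^ (2 : ℕ) *
          ENNReal.ofReal ((‖y - x₀‖ ^ 4)⁻¹) := h1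
    _ ≤ ENNReal.ofReal (CK * r) * (Kt * ENNReal.ofReal ((2 * r - 1)⁻¹) * α) :=
        mul_le_mul' le_rfl htail
    _ = _ := by ring

/-- `‖1_B w‖ₑ² = 1_B ‖w‖ₑ²` pointwise. [folklore] -/
theorem enorm_indicator_sq (s : Set (EuclideanSpace ℝ (Fin 3)))
    (w : EuclideanSpace ℝ (Fin 3) → EuclideanSpace ℝ (Fin 3)) (y : EuclideanSpace ℝ (Fin 3)) :
    ‖s.indicator w y‖ₑ ^ 2 = s.indicator (fun y => ‖w y‖ₑ ^ 2) y := by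
  by_cases hy : y ∈ s
  · rw [indicator_of_mem hy, indicator_of_mem hy]
  · rw [indicator_of_notMem hy, indicator_of_notMem hy, enorm_zero, zero_pow two_ne_zero]

/-- `eLpNorm f 2 = (∫⁻ ‖f‖ₑ²)^{1/2}` with a natural-number square. [folklore] -/
theorem eLpNorm_two_eq_sqrt {f : EuclideanSpace ℝ (Fin 3) → EuclideanSpace ℝ (Fin 3)} :
    eLpNorm f 2 volume = (∫⁻ x, ‖f x‖ₑ ^ 2) ^ (1 / 2 : ℝ) := by
  rw [eLpNorm_eq_lintegral_rpow_enorm_toReal two_ne_zero ENNReal.ofNat_ne_top, ENNReal.toReal_ofNat]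
  congr 1
  refine lintegral_congr fun x => ?_
  rw [show (2 : ℝ) = ((2 : ℕ) : ℝ) by norm_num, ENNReal.rpow_natCast]

/-- `eLpNorm f 2 · eLpNorm f 2 = ∫⁻ ‖f‖ₑ²`. [folklore] -/
theorem eLpNorm_two_mul_self {f : EuclideanSpace ℝ (Fin 3) → EuclideanSpace ℝ (Fin 3)} :
    eLpNorm f 2 volume * eLpNorm f 2 volume = ∫⁻ x, ‖f x‖ₑ ^ 2 := by
  rw [eLpNorm_two_eq_sqrt, ← ENNReal.rpow_add_of_nonneg _ _ (by norm_num) (by norm_num),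
    show (1 / 2 : ℝ) + 1 / 2 = 1 by norm_num, ENNReal.rpow_one]

/-- **§M29(c) The pressure pairing of the local energy inequality is LINEAR in the local energy
under a sup bound, with `M`-free constants.**  For every `r ≥ 1` there are finite constants
`C₁` (absolute) and `C₂ = C₂(r)` such that: for every measurable slice `w : ℝ³ → ℝ³` with
`|w|² ∈ L¹ ∩ L^{3/2}` (finite energy, `L³`), bounded by `K_b` on the ball `B(x₀, 2r)`, with
uniformly local energy `sup_z ∫_{B(z,1)} |w|² ≤ α`, and every measurable test field `g` with
`|g| ≤ C_g`, supported in `B(x₀, r)` and ORTHOGONAL to `w` (`∫ ⟪w, g⟫ = 0` — for `g = ∇φ` this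
is `div w = 0`),

  `|∫ p̃[w] ⟪w, g⟫ dx| ≤ K_b · C_g · (C₁ ∫_{B(x₀,2r)} |w|² + C₂ · α)`.

ONE power of `K_b`: under the Type-I rate `K_b = M/√(T − s)` the weight is integrable in time, so
the pressure term of the local energy inequality is a LINEAR functional of the local energies with
an `L¹` weight whose norm depends on `M` only — the step that makes an `M`-only uniformly-local
Gronwall bound (door X″) possible.  Proof: the split (b) `p̃[w] = π_near + π_far + c` on
`B(x₀, r)`; the constant `c` pairs to zero against `⟪w, g⟫`; `|∫ π_near ⟪w,g⟫| ≤ C_g ‖π_near‖₂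
‖1_{B_r} w‖₂ ≤ C_g · C K_b ‖1_{B_{2r}} w‖₂²` by (a); `|π_far| ≤ F(r) α` on `B(x₀, r)` by the
uniformly-local far-field bound, and `∫ |⟪w, g⟫| ≤ K_b C_g |B_r|`.  (Jia–Šverák 2014 (3.3) and
Kang–Miura–Tsai 2021 Lemma 3.4 give the same pairing with `‖w‖_{L³}`-type control, quadratic
under a sup bound; the linear-in-`K_b` form is the present bookkeeping.) [cite: JiaSverak2014, formula (3.3) p. 7] [cite: KangMiuraTsai2020, Lemma 3.4, arXiv:1812.10509 p. 8] [cite: Stein1970, Ch. II §4.2 Thm 3] -/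
theorem exists_pressurePairing_le_linear {r : ℝ} (hr : 1 ≤ r) :
    ∃ C₁ C₂ : ℝ≥0∞, C₁ ≠ ⊤ ∧ C₂ ≠ ⊤ ∧
      ∀ {w g : EuclideanSpace ℝ (Fin 3) → EuclideanSpace ℝ (Fin 3)} {x₀ : EuclideanSpace ℝ (Fin 3)}
        {Kb Cg : ℝ} {α : ℝ≥0∞}, 0 ≤ Kb → 0 ≤ Cg → AEStronglyMeasurable w volume →
        Integrable (fun y => ‖w y‖ ^ 2) volume →
        MemLp (fun y => ‖w y‖ ^ 2) (3 / 2 : ℝ≥0∞) volume →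
        (∀ y ∈ ball x₀ (2 * r), ‖w y‖ ≤ Kb) →
        (∀ z : EuclideanSpace ℝ (Fin 3), ∫⁻ y in ball z 1, ‖w y‖ₑ ^ 2 ≤ α) →
        AEStronglyMeasurable g volume → (∀ x, ‖g x‖ ≤ Cg) → (∀ x ∉ ball x₀ r, g x = 0) →
        ∫ x, ⟪w x, g x⟫ = 0 →
        ‖∫ x, normalisedPressure w x * ⟪w x, g x⟫‖ₑ ≤
          ENNReal.ofReal (Kb * Cg) * (C₁ * (∫⁻ y in ball x₀ (2 * r), ‖w y‖ₑ ^ 2) + C₂ * α) := by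
  have hr0 : 0 < r := by linarith
  obtain ⟨C, hC⟩ := exists_eLpNorm_nearPressure_two_le_linear
  obtain ⟨F, hFt, hF⟩ := exists_enorm_farPressure_le_of_uloc hr
  set V : ℝ≥0∞ := volume (ball (0 : EuclideanSpace ℝ (Fin 3)) r) with hV
  refine ⟨C, F * V, ENNReal.coe_ne_top, ENNReal.mul_ne_top hFt measure_ball_lt_top.ne, ?_⟩
  intro w g x₀ Kb Cg α hKb hCg hw hw2 hw3 hb hα hg hgb hg0 horth
  -- the split (b) on `B(x₀, r)` and the far-field bound
  have hsplit := normalisedPressure_eq_near_add_far_add_const hw hw2 hw3 x₀ hr0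
  have hfar := fun x (hx : x ∈ ball x₀ r) => hF hw hα x hx
  set a : EuclideanSpace ℝ (Fin 3) → EuclideanSpace ℝ (Fin 3) := (ball x₀ (2 * r)).indicator w with ha
  set a' : EuclideanSpace ℝ (Fin 3) → EuclideanSpace ℝ (Fin 3) := (ball x₀ r).indicator w with ha'
  set c : ℝ := ∫ y in (ball x₀ (2 * r))ᶜ, pressureKernel (x₀ - y) (w y) with hc
  set far : EuclideanSpace ℝ (Fin 3) → ℝ := fun x =>
    ∫ y in (ball x₀ (2 * r))ᶜ, (pressureKernel (x - y) (w y) - pressureKernel (x₀ - y) (w y))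
    with hfar_def
  set φ : EuclideanSpace ℝ (Fin 3) → ℝ := fun x => ⟪w x, g x⟫ with hφ
  -- facts about `φ = ⟪w, g⟫`
  have hφm : AEStronglyMeasurable φ volume := hw.inner hg
  have hφ0 : ∀ x ∉ ball x₀ r, φ x = 0 := fun x hx => by
    simp only [hφ, hg0 x hx, inner_zero_right]
  have hφKb : ∀ x, ‖φ x‖ ≤ (ball x₀ r).indicator (fun _ => Kb * Cg) x := fun x => by
    by_cases hx : x ∈ ball x₀ r
    · rw [indicator_of_mem hx]
      have hx1 : x ∈ ball x₀ (2 * r) := ball_subset_ball (by linarith) hx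
      exact (norm_inner_le_norm _ _).trans (mul_le_mul (hb x hx1) (hgb x) (norm_nonneg _) hKb)
    · rw [indicator_of_notMem hx, hφ0 x hx, norm_zero]
  have hφa' : ∀ x, ‖φ x‖ₑ ≤ ENNReal.ofReal Cg * ‖a' x‖ₑ := fun x => by
    by_cases hx : x ∈ ball x₀ r
    · rw [ha', indicator_of_mem hx, ← ofReal_norm, ← ofReal_norm, ← ENNReal.ofReal_mul hCg]
      refine ENNReal.ofReal_le_ofReal ((norm_inner_le_norm _ _).trans ?_)
      rw [mul_comm]
      exact mul_le_mul_of_nonneg_right (hgb x) (norm_nonneg _)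
    · rw [hφ0 x hx, enorm_zero]; exact bot_le
  have hKC : Integrable ((ball x₀ r).indicator fun _ : EuclideanSpace ℝ (Fin 3) => Kb * Cg) volume :=
    (integrableOn_const (measure_ball_lt_top.ne)).integrable_indicator measurableSet_ball
  have hφi : Integrable φ volume := hKC.mono' hφm (Eventually.of_forall hφKb)
  -- the constant part of the pressure pairs to zero; reduce to the integrable case
  by_cases hint : Integrable (fun x => normalisedPressure w x * φ x) volume
  swap
  · rw [integral_undef hint, enorm_zero]; exact bot_le
  have hsub : ∫ x, normalisedPressure w x * φ x = ∫ x, (normalisedPressure w x * φ x - c * φ x) := by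
    rw [integral_sub hint (hφi.const_mul c), integral_const_mul, horth, mul_zero, sub_zero]
  rw [hsub]
  -- pointwise: `|p̃ φ − c φ| ≤ (|π_near| + F α) |φ|`
  have hpt : ∀ᵐ x : EuclideanSpace ℝ (Fin 3),
      ‖normalisedPressure w x * φ x - c * φ x‖ₑ ≤
        ‖normalisedPressure a x‖ₑ * ‖φ x‖ₑ + F * α * ‖φ x‖ₑ := by
    filter_upwards [hsplit] with x hx
    by_cases hxB : x ∈ ball x₀ r
    · have heq : normalisedPressure w x * φ x - c * φ x = (normalisedPressure a x + far x) * φ x := by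
        rw [hx hxB]; ring
      rw [heq, enorm_mul, ← add_mul]
      gcongr
      exact (enorm_add_le _ _).trans (add_le_add le_rfl (hfar x hxB))
    · rw [hφ0 x hxB, mul_zero, mul_zero, sub_zero, enorm_zero]; exact bot_le
  -- the near term by Hölder and (a)
  have ham : AEStronglyMeasurable a volume := hw.indicator measurableSet_ball
  have ha'm : AEStronglyMeasurable a' volume := hw.indicator measurableSet_ball
  have ha2 : Integrable (fun y => ‖a y‖ ^ 2) volume := by
    have : (fun y => ‖a y‖ ^ 2) = (ball x₀ (2 * r)).indicator (fun y => ‖w y‖ ^ 2) :=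
      funext fun y => norm_indicator_sq _ w y
    rw [this]; exact hw2.indicator measurableSet_ball
  have hnear_m : AEStronglyMeasurable (normalisedPressure a) volume := aestronglyMeasurable_normalisedPressure_of_sq_integrable ham ha2
  have hnear2 : eLpNorm (normalisedPressure a) 2 volume ≤ C * ENNReal.ofReal Kb * eLpNorm a 2 volume :=
    hC hKb hw hw2.integrableOn hb
  have ha'a : eLpNorm a' 2 volume ≤ eLpNorm a 2 volume := by
    refine eLpNorm_mono fun x => ?_
    by_cases hx : x ∈ ball x₀ r
    · rw [ha', ha, indicator_of_mem hx, indicator_of_mem (ball_subset_ball (by linarith) hx)]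
    · rw [ha', indicator_of_notMem hx, norm_zero]; exact norm_nonneg _
  have hX : ∫⁻ x, ‖a x‖ₑ ^ 2 = ∫⁻ y in ball x₀ (2 * r), ‖w y‖ₑ ^ 2 := by
    rw [← lintegral_indicator measurableSet_ball]
    exact lintegral_congr fun x => enorm_indicator_sq _ w x
  have hnear : ∫⁻ x, ‖normalisedPressure a x‖ₑ * ‖φ x‖ₑ ≤
      ENNReal.ofReal Cg * (C * ENNReal.ofReal Kb * ∫⁻ y in ball x₀ (2 * r), ‖w y‖ₑ ^ 2) := by
    have hpq : (2 : ℝ).HolderConjugate 2 := Real.holderConjugate_iff.2 ⟨by norm_num, by norm_num⟩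
    calc ∫⁻ x, ‖normalisedPressure a x‖ₑ * ‖φ x‖ₑ
        ≤ ∫⁻ x, ‖normalisedPressure a x‖ₑ * (ENNReal.ofReal Cg * ‖a' x‖ₑ) :=
          lintegral_mono fun x => mul_le_mul' le_rfl (hφa' x)
      _ = ENNReal.ofReal Cg * ∫⁻ x, ((fun x => ‖normalisedPressure a x‖ₑ) * fun x => ‖a' x‖ₑ) x := by
          rw [← lintegral_const_mul' _ _ ENNReal.ofReal_ne_top]
          exact lintegral_congr fun x => by simp only [Pi.mul_apply]; ring
      _ ≤ ENNReal.ofReal Cg * ((∫⁻ x, ‖normalisedPressure a x‖ₑ ^ (2 : ℝ)) ^ (1 / (2 : ℝ)) *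
            (∫⁻ x, ‖a' x‖ₑ ^ (2 : ℝ)) ^ (1 / (2 : ℝ))) := by
          gcongr
          exact ENNReal.lintegral_mul_le_Lp_mul_Lq volume hpq hnear_m.enorm ha'm.enorm
      _ = ENNReal.ofReal Cg * (eLpNorm (normalisedPressure a) 2 volume * eLpNorm a' 2 volume) := by
          rw [eLpNorm_eq_lintegral_rpow_enorm_toReal two_ne_zero ENNReal.ofNat_ne_top,
            eLpNorm_eq_lintegral_rpow_enorm_toReal two_ne_zero ENNReal.ofNat_ne_top, ENNReal.toReal_ofNat]
      _ ≤ ENNReal.ofReal Cg * ((C * ENNReal.ofReal Kb * eLpNorm a 2 volume) * eLpNorm a 2 volume) := by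
          gcongr
      _ = ENNReal.ofReal Cg * (C * ENNReal.ofReal Kb * ∫⁻ y in ball x₀ (2 * r), ‖w y‖ₑ ^ 2) := by
          rw [mul_assoc (C * ENNReal.ofReal Kb), eLpNorm_two_mul_self, hX]
  -- the far term
  have hfarI : ∫⁻ x, F * α * ‖φ x‖ₑ ≤ F * α * (ENNReal.ofReal (Kb * Cg) * volume (ball x₀ r)) := by
    calc ∫⁻ x, F * α * ‖φ x‖ₑ
        ≤ ∫⁻ x, F * α * (ball x₀ r).indicator (fun _ => ENNReal.ofReal (Kb * Cg)) x := by
          refine lintegral_mono fun x => mul_le_mul' le_rfl ?_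
          by_cases hx : x ∈ ball x₀ r
          · rw [indicator_of_mem hx, ← ofReal_norm]
            exact ENNReal.ofReal_le_ofReal ((hφKb x).trans_eq (by rw [indicator_of_mem hx]))
          · rw [hφ0 x hx, enorm_zero]; exact bot_le
      _ = F * α * (ENNReal.ofReal (Kb * Cg) * volume (ball x₀ r)) := by
          rw [lintegral_const_mul'' _ ((measurable_const.indicator measurableSet_ball).aemeasurable),
            lintegral_indicator_const measurableSet_ball]
  have hVx : volume (ball x₀ r) = V := by
    rw [hV, Measure.addHaar_ball_center]
  -- assemble
  calc ‖∫ x, (normalisedPressure w x * φ x - c * φ x)‖ₑ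
      ≤ ∫⁻ x, ‖normalisedPressure w x * φ x - c * φ x‖ₑ := enorm_integral_le_lintegral_enorm _
    _ ≤ ∫⁻ x, (‖normalisedPressure a x‖ₑ * ‖φ x‖ₑ + F * α * ‖φ x‖ₑ) := lintegral_mono_ae hpt
    _ = (∫⁻ x, ‖normalisedPressure a x‖ₑ * ‖φ x‖ₑ) + ∫⁻ x, F * α * ‖φ x‖ₑ :=
        lintegral_add_right' _ (hφm.enorm.const_mul _)
    _ ≤ ENNReal.ofReal Cg * (C * ENNReal.ofReal Kb * ∫⁻ y in ball x₀ (2 * r), ‖w y‖ₑ ^ 2) +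
          F * α * (ENNReal.ofReal (Kb * Cg) * volume (ball x₀ r)) := add_le_add hnear hfarI
    _ = ENNReal.ofReal (Kb * Cg) * (C * (∫⁻ y in ball x₀ (2 * r), ‖w y‖ₑ ^ 2) + F * V * α) := by
        rw [hVx, ENNReal.ofReal_mul hKb]; ring

end Summit.NavierStokesRegularity.NavierStokesRegularity.Theorems.StrainDoors

end
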